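import Mathlib
import Summits.ValiantsHypothesis.ValiantsHypothesis.Theorems.NewtonTauWeak.Negative.Zonogon
import Summits.ValiantsHypothesis.ValiantsHypothesis.Theorems.NewtonUnitEquationsDissociatedUniformQuasiPoly

/-!
# `NewtonTauWeak` (stmt-ValiantsHypothesis-5904), line `binomial-normal-form`: Theorem Q in the
# admissible crux shape `2^{a m} (k t + 2)^{b ⌈log₂ (m+2)⌉}` with `a = 0`

Rung toward the crux `Summit.ValiantsHypothesis.ValiantsHypothesis.Theses.NewtonUnitEquations.NewtonTauWeak`
(KPTT arXiv:1308.2286, Conjecture 1 in the weak form of their Theorem 1), registered stub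
`stub_dissociatedQuasiShape`.

Claim.  On a DISSOCIATED frame `A : Fin m → Finset ℕ²` (the sum map `Π_j A j → ℕ²` is injective) with
`|A j| ≤ t`, for bivariate complex polynomials `f i j` (`i < k`, `j < m`) with `supp (f i j) ⊆ A j`, the
Newton polygon of `Σ_{i<k} Π_{j<m} f i j` has at most `(k t + 2) ^ (7 ⌈log₂ (m + 2)⌉)` vertices (`vert`, the
crux's literal vertex count) — the quasi-polynomial shape `2^{a m} (k t + 2)^{b ⌈log₂ (m+2)⌉}` with `a = 0`,
`b = 7`, i.e. with NO factor `2^{a m}`.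

Proof.  Pure repackaging of Theorem Q (`dissociated_quasiPoly`:
`vert ≤ (t + 2) · (8 (k + 2)³)^⌈log₂ m⌉`).  If `k = 0`, or `t = 0 < m` (then `A 0 = ∅` forces `f i 0 = 0`),
the polynomial vanishes and has no vertex (`vert_le_card_support`).  If `m = 0`, Theorem Q reads
`vert ≤ t + 2 ≤ k t + 2`.  Otherwise `k, t ≥ 1`; with `x = k t + 2 ≥ 3` one has `t + 2 ≤ x`, `k + 2 ≤ x` and
`8 ≤ x²`, hence `8 (k + 2)³ ≤ x⁵` and Theorem Q's bound is `≤ x^(5 ⌈log₂ m⌉ + 1) ≤ x^(7 ⌈log₂ (m+2)⌉)` because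
`⌈log₂ m⌉ ≤ ⌈log₂ (m + 2)⌉` and `⌈log₂ (m + 2)⌉ ≥ 1`.  No definitions, no named facts. [folklore]
-/

-- the namespace mandated for this Theorems file repeats the component `ValiantsHypothesis`
set_option linter.dupNamespace false

noncomputable section

open scoped BigOperators
open MvPolynomial
open Summit.ValiantsHypothesis.ValiantsHypothesis.Theorems.NewtonTauWeak.Negative (vert vert_le_card_support)
open Summit.ValiantsHypothesis.ValiantsHypothesis.Theorems.NewtonUnitEquationsDissociatedUniform
  (dissociated_quasiPoly)

namespace Summit.ValiantsHypothesis.ValiantsHypothesis.Theorems.NewtonUnitEquationsNewtonTauWeak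

namespace DissociatedQuasiShapeAux

/-- The exponent arithmetic of the main case: if `x ≥ 3` dominates `t + 2` and `k + 2`, and `c ≤ c'` with
`1 ≤ c'`, then `(t + 2) · (8 (k + 2)³)^c ≤ x^(7 c')` (via `8 (k + 2)³ ≤ x² · x³ = x⁵` and
`5 c + 1 ≤ 7 c'`). [folklore] -/
theorem repack (x k t c c' : ℕ) (hx : 3 ≤ x) (ht : t + 2 ≤ x) (hk : k + 2 ≤ x) (hc : c ≤ c')
    (hc' : 1 ≤ c') : (t + 2) * (8 * (k + 2) ^ 3) ^ c ≤ x ^ (7 * c') := by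
  have h8 : 8 ≤ x ^ 2 := by nlinarith
  have hβ : 8 * (k + 2) ^ 3 ≤ x ^ 5 := by
    calc 8 * (k + 2) ^ 3 ≤ x ^ 2 * x ^ 3 := Nat.mul_le_mul h8 (Nat.pow_le_pow_left hk 3)
      _ = x ^ 5 := by ring
  calc (t + 2) * (8 * (k + 2) ^ 3) ^ c ≤ x * (x ^ 5) ^ c := Nat.mul_le_mul ht (Nat.pow_le_pow_left hβ _)
    _ = x ^ (5 * c + 1) := by rw [← pow_mul]; ring
    _ ≤ x ^ (7 * c') := Nat.pow_le_pow_right (by omega) (by omega)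

/-- The degenerate case `m = 0` of the arithmetic: `t + 2 ≤ (k t + 2)^(7 c')` as soon as `k, c' ≥ 1`.
[folklore] -/
theorem repack_zero (k t c' : ℕ) (hk : 1 ≤ k) (hc' : 1 ≤ c') : t + 2 ≤ (k * t + 2) ^ (7 * c') := by
  have ht : t + 2 ≤ k * t + 2 := by nlinarith
  calc t + 2 ≤ k * t + 2 := ht
    _ = (k * t + 2) ^ 1 := (pow_one _).symm
    _ ≤ (k * t + 2) ^ (7 * c') := Nat.pow_le_pow_right (by omega) (by omega)

end DissociatedQuasiShapeAux

open DissociatedQuasiShapeAux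

/-- **Theorem Q in the admissible crux shape (registered stub `stub_dissociatedQuasiShape`).**  On a dissociated
frame (`≤ t` letters per factor, injective sum map `Π_j A j → ℕ²`) the Newton polygon of `Σ_{i<k} Π_{j<m} f i j`
has at most `(k t + 2) ^ (7 ⌈log₂ (m + 2)⌉)` vertices: the shape `2^{a m} (k t + 2)^{b ⌈log₂ (m+2)⌉}` of the
quasi-form of the crux `NewtonTauWeak` with `a = 0`, `b = 7`.  (From `dissociated_quasiPoly`,
`(t + 2)(8 (k + 2)³)^⌈log₂ m⌉`, by `t + 2 ≤ k t + 2` and `8 (k + 2)³ ≤ (k t + 2)⁵` for `k, t ≥ 1`; `k = 0` or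
`t = 0 < m` make the sum vanish, `m = 0` makes it constant.) [folklore] -/
theorem stub_dissociatedQuasiShape (k m t : ℕ) (A : Fin m → Finset (Fin 2 →₀ ℕ))
    (f : Fin k → Fin m → MvPolynomial (Fin 2) ℂ) (hcard : ∀ j, (A j).card ≤ t)
    (hsupp : ∀ i j, (f i j).support ⊆ A j)
    (hdis : ∀ u v : Fin m → (Fin 2 →₀ ℕ), (∀ j, u j ∈ A j) → (∀ j, v j ∈ A j) → ∑ j, u j = ∑ j, v j → u = v) :
    vert (∑ i, ∏ j, f i j) ≤ (k * t + 2) ^ (7 * Nat.clog 2 (m + 2)) := by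
  classical
  have hQ : vert (∑ i, ∏ j, f i j) ≤ (t + 2) * (8 * (k + 2) ^ 3) ^ Nat.clog 2 m :=
    dissociated_quasiPoly k m t A f hcard hsupp hdis
  -- the vanishing cases: `k = 0`, or `t = 0 < m`
  have hzero : (∑ i, ∏ j, f i j) = 0 → vert (∑ i, ∏ j, f i j) ≤ (k * t + 2) ^ (7 * Nat.clog 2 (m + 2)) := by
    intro h
    calc vert (∑ i, ∏ j, f i j) ≤ (∑ i, ∏ j, f i j).support.card := vert_le_card_support _
      _ = 0 := by rw [h, MvPolynomial.support_zero, Finset.card_empty]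
      _ ≤ (k * t + 2) ^ (7 * Nat.clog 2 (m + 2)) := Nat.zero_le _
  have hc' : 1 ≤ Nat.clog 2 (m + 2) := Nat.clog_pos one_lt_two (by omega)
  have hc : Nat.clog 2 m ≤ Nat.clog 2 (m + 2) := Nat.clog_mono_right 2 (by omega)
  rcases Nat.eq_zero_or_pos k with rfl | hk
  · exact hzero (by simp)
  rcases Nat.eq_zero_or_pos m with rfl | hm
  · -- `m = 0`: Theorem Q reads `vert ≤ t + 2`
    calc vert (∑ i, ∏ j, f i j) ≤ (t + 2) * (8 * (k + 2) ^ 3) ^ Nat.clog 2 0 := hQ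
      _ = t + 2 := by rw [Nat.clog_zero_right, pow_zero, mul_one]
      _ ≤ (k * t + 2) ^ (7 * Nat.clog 2 (0 + 2)) := repack_zero k t _ hk hc'
  rcases Nat.eq_zero_or_pos t with rfl | ht
  · -- `t = 0 < m`: `A ⟨0, hm⟩ = ∅`, so `f i ⟨0, hm⟩ = 0` and the polynomial vanishes
    apply hzero
    have hj : A ⟨0, hm⟩ = ∅ := Finset.card_eq_zero.mp (Nat.le_zero.mp (hcard ⟨0, hm⟩))
    have hf : ∀ i, f i ⟨0, hm⟩ = 0 := by
      intro i
      have := hsupp i ⟨0, hm⟩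
      rw [hj, Finset.subset_empty, MvPolynomial.support_eq_empty] at this
      exact this
    refine Finset.sum_eq_zero fun i _ => ?_
    exact Finset.prod_eq_zero (Finset.mem_univ (⟨0, hm⟩ : Fin m)) (hf i)
  -- the main case `k, m, t ≥ 1`
  have hx3 : 3 ≤ k * t + 2 := by
    have : 1 ≤ k * t := Nat.mul_pos hk ht
    omega
  have ht2 : t + 2 ≤ k * t + 2 := by nlinarith
  have hk2 : k + 2 ≤ k * t + 2 := by nlinarith
  exact hQ.trans (repack (k * t + 2) k t _ _ hx3 ht2 hk2 hc hc')

end Summit.ValiantsHypothesis.ValiantsHypothesis.Theorems.NewtonUnitEquationsNewtonTauWeak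

end
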